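import Mathlib
import Summits.KontsevichZagierPeriods.Zeta5Search.LawA5Proof
import HarnessLib

/-!
# ζ(5) search — THEOREM L5⁺: THEOREM L5 (`SecondResidueLaw.LawA5`) with the two deepest layers EMPTY gains one more digit: `v_p(Cas_j(b)) ≥ 9 − 2M`

Cell `pub-zeta5` (HONEST FRAMING: systematic search; no irrationality claim unless certified), track «DENOM-LAW», seat `denom-prover-d1`
gen 10 (ATTEMPT-10 §7–§9).  `p`-adic valuations of the cell's OWN explicit rationals (the contiguity Casoratian of the Brown–Zudilin dual
coefficients); nothing here is a statement about ζ(5); no γ of record moves; records in print UNMOVED.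

THE STATEMENT (`lawA5_shifted`).  Hypotheses of THEOREM L5 (`lawA5_holds`: frame `(M, T)`, `M ≥ 10` even, `T` a palindrome, `LawA4Classes`
and `ShapeClause` for `b` and `b + e_j`, degree condition `p(M − 4) ≤ 2 d(b) + 1`), AND: every multipole class of `b` and of `b + e_j` has
exponent `≥ −M + 2` and every single-pole class has `ν ≥ −M + 2` (the layers `−M` and `−M + 1` of the frame are EMPTY).  Then
`v_p(Cas_j(b)) ≥ 9 − 2M` (L5 gives `8 − 2M`).
WHY (three lines on top of `lawA5_of_residueLaw`): with both deep layers empty the normalised coefficients `w = W/(−p)^{3−M}`, `v = V/(−p)^{−M}` are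
themselves `O(p²)` (crude class bounds, `coeff_norm_of_layer`), so in L5's collinearity `2(w,v) ≡ A·t₁ (mod p⁴)` the products `A·t₁` are `O(p²)`
instead of `O(p)`, and the `2 × 2` minor vanishes to order `p⁶` (`det₆`) instead of `p⁵`; the top-layer case is `O(p⁶)` by the crude bounds alone.

WHERE IT COMES FROM / EVIDENCE (HOME `denom-law/prover-d1/ATTEMPT-10.md` §7–§9, `g10/code/fp_sampler.py`, `lawL6.py`): a per-prime sampler of the
whole first-period accounting law (`DenomLaw.PathAccountingFirstPeriod`) at `p = 11, 13` found its value one unit above EVERY landed rung on ≈ 10 %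
of random cells, half of them at ⌊d/p⌋ = 3 in frames whose two deepest layers are empty (deep classes = conjugate pairs (−5,−3)/(−3,−5) = double
raises of `T = (−5,−5)` at exponent `−8`, frame `M = 10`), with a sharp EDGE at L5's degree condition `6p ≤ 2d + 1`; this theorem is that
mechanism.  Exhaustive small cells (b₀ ≤ 16, all window primes, all admissible `j`): where its guard fires, 0 violations of `9 − 2M` (tight on a third).
-/

noncomputable section

open Finset PowerSeries

namespace Summit.KontsevichZagierPeriods.Zeta5Search.SecondOrder

open Summit.KontsevichZagierPeriods.Zeta5Search.WedgeDictionary (coeffW coeffV dOf)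
open Summit.KontsevichZagierPeriods.Zeta5Search.CasoratianValuation (InPolytope shift casoratian)
open Summit.KontsevichZagierPeriods.Zeta5Search.ClusterValuation
open Summit.KontsevichZagierPeriods.Zeta5Search.PadicSeries
open Summit.KontsevichZagierPeriods.Zeta5Search.CellA (classW coeffW_eq_sum_classW padicNorm_p)
open Summit.KontsevichZagierPeriods.Zeta5Search.LevelClass (typeExp)
open Summit.KontsevichZagierPeriods.Zeta5Search.BigPrime (shift_zero padicNorm_mul_le_one dOf_shift)
open Summit.KontsevichZagierPeriods.Zeta5Search.RecordWindowsA4 (LawA4Classes)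
open Summit.KontsevichZagierPeriods.Zeta5Search.SecondResidueLaw (ShapeClause FourthDigitW FourthDigitV)

variable {p : ℕ} [hp : Fact p.Prime]

/-! ## §1 The determinant estimate at order six -/

/-- **Fourth-order collinearity with `O(p²)` directions kills five digits**: if `2w ≡ At_W`, `2v ≡ At_V`, `2w' ≡ A't_W`, `2v' ≡ A't_V (mod p⁴)`
with `‖At‖, ‖A't‖ ≤ p⁻²` (componentwise), then `‖w'v − wv'‖ ≤ p⁻⁶`. -/
theorem det₆ (hp2 : p ≠ 2) {w v w' v' A A' tW tV : ℚ}
    (hw : padicNorm p (2 * w - A * tW) ≤ (p : ℚ) ^ (-(4 : ℤ))) (hv : padicNorm p (2 * v - A * tV) ≤ (p : ℚ) ^ (-(4 : ℤ)))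
    (hw' : padicNorm p (2 * w' - A' * tW) ≤ (p : ℚ) ^ (-(4 : ℤ))) (hv' : padicNorm p (2 * v' - A' * tV) ≤ (p : ℚ) ^ (-(4 : ℤ)))
    (hAW : padicNorm p (A * tW) ≤ (p : ℚ) ^ (-(2 : ℤ))) (hAV : padicNorm p (A * tV) ≤ (p : ℚ) ^ (-(2 : ℤ)))
    (hAW' : padicNorm p (A' * tW) ≤ (p : ℚ) ^ (-(2 : ℤ))) (hAV' : padicNorm p (A' * tV) ≤ (p : ℚ) ^ (-(2 : ℤ))) :
    padicNorm p (w' * v - w * v') ≤ (p : ℚ) ^ (-(6 : ℤ)) := by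
  have h4 : padicNorm p ((1 : ℚ) / 4) = 1 := by
    rw [show ((1 : ℚ) / 4) = 1 / (2 * 2) by norm_num, padicNorm.div, padicNorm.one, padicNorm.mul, padicNorm_two hp2]; norm_num
  have hexp : w' * v - w * v' = (1 : ℚ) / 4 *
      (((2 * w' - A' * tW) * (2 * v - A * tV) - (2 * w - A * tW) * (2 * v' - A' * tV))
        + ((2 * w' - A' * tW) * (A * tV) + (A' * tW) * (2 * v - A * tV) - (2 * w - A * tW) * (A' * tV)
            - (A * tW) * (2 * v' - A' * tV))) := by ring
  rw [hexp, padicNorm.mul, h4, one_mul]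
  have hrr : ∀ {a c : ℚ}, padicNorm p a ≤ (p : ℚ) ^ (-(4 : ℤ)) → padicNorm p c ≤ (p : ℚ) ^ (-(4 : ℤ)) →
      padicNorm p (a * c) ≤ (p : ℚ) ^ (-(6 : ℤ)) := fun ha hc => fo_weak (fo_mul ha hc) (by norm_num)
  have hra : ∀ {a c : ℚ}, padicNorm p a ≤ (p : ℚ) ^ (-(4 : ℤ)) → padicNorm p c ≤ (p : ℚ) ^ (-(2 : ℤ)) →
      padicNorm p (a * c) ≤ (p : ℚ) ^ (-(6 : ℤ)) := fun ha hc => by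
    have h := fo_mul ha hc; rwa [show (-((4 : ℤ) + 2)) = -6 by norm_num] at h
  have har : ∀ {a c : ℚ}, padicNorm p a ≤ (p : ℚ) ^ (-(2 : ℤ)) → padicNorm p c ≤ (p : ℚ) ^ (-(4 : ℤ)) →
      padicNorm p (a * c) ≤ (p : ℚ) ^ (-(6 : ℤ)) := fun ha hc => by
    have h := fo_mul ha hc; rwa [show (-((2 : ℤ) + 4)) = -6 by norm_num] at h
  exact fo_add (fo_sub (hrr hw' hv) (hrr hw hv'))
    (fo_sub (fo_sub (fo_add (hra hw' hAV) (har hAW' hv)) (hra hw hAV')) (har hAW hv'))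

/-! ## §2 Crude bounds above a layer -/

/-- **If every multipole class has `E ≥ −M + k` and every single-pole class `ν ≥ −M + k` (`−M + k ≤ −3`), then
`‖W‖ ≤ p^{M−k−3}` and `‖V‖ ≤ p^{M−k}`.** -/
theorem coeff_norm_of_layer (b : ℕ → ℤ) (hb : InPolytope b) (hp5 : 5 ≤ p) (hwin : (b 0 + 2 : ℤ) < (p : ℤ) ^ 2) {M : ℕ} {k : ℤ}
    (hk : -(M : ℤ) + k ≤ -3)
    (hall : ∀ x < p, 2 ≤ classPoleCount b p x → -(M : ℤ) + k ≤ classExp b p x)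
    (hsing : ∀ y < p, classPoleCount b p y = 1 → -(M : ℤ) + k ≤ classNu b p y) :
    padicNorm p (coeffW b) ≤ (p : ℚ) ^ (-((-(M : ℤ) + k) + 3)) ∧ padicNorm p (coeffV b) ≤ (p : ℚ) ^ (-(-(M : ℤ) + k)) := by
  have hp0 : 0 < p := hp.out.pos
  refine ⟨?_, ?_⟩
  · rw [coeffW_eq_sum_classW b hp0]
    exact padicNorm.sum_le' (fun x hx => CellD.padicNorm_classW_le b hb hp5 hwin hk (hall x (mem_range.1 hx)))
      (zpow_p_nonneg _)
  · rw [coeffV_eq_sum_classV b hp0]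
    refine padicNorm.sum_le' (fun x hx => ?_) (zpow_p_nonneg _)
    have hx' := mem_range.1 hx
    refine CellD.padicNorm_classV_le_of b hb hp5 hwin hx' fun h1 => ?_
    by_cases h2 : 2 ≤ classPoleCount b p x
    · exact (hall x hx' h2).trans (CellA.classExp_le_classNu b p x)
    · exact hsing x hx' (by omega)

/-! ## §3 THEOREM L5⁺ -/

/-- **THEOREM L5⁺ (two empty layers).**  Under the hypotheses of THEOREM L5 (`SecondResidueLaw.LawA5`) and, for `b` and `b + e_j`, every
multipole class exponent `≥ −M + 2` and every single-pole `ν ≥ −M + 2`: `v_p(Cas_j(b)) ≥ 9 − 2M`. -/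
theorem lawA5_shifted (b : ℕ → ℤ) (j M : ℕ) (T : List ℤ) (hb : InPolytope b) (hb' : InPolytope (shift b j)) (hj : 1 ≤ j ∧ j ≤ 7)
    (hp5 : 5 ≤ p) (hpb : (p : ℤ) ≤ b 0) (hwin : (b 0 + 2 : ℤ) < (p : ℤ) ^ 2) (hM : 10 ≤ M ∧ Even M) (hT : T.reverse = T)
    (hC : LawA4Classes b p M T) (hC' : LawA4Classes (shift b j) p M T) (hS : ShapeClause b p M T) (hS' : ShapeClause (shift b j) p M T)
    (hdeg : (p : ℤ) * ((M : ℤ) - 4) ≤ 2 * dOf b + 1)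
    (hE2 : ∀ x < p, 2 ≤ classPoleCount b p x → -(M : ℤ) + 2 ≤ classExp b p x)
    (hN2 : ∀ y < p, classPoleCount b p y = 1 → -(M : ℤ) + 2 ≤ classNu b p y)
    (hE2' : ∀ x < p, 2 ≤ classPoleCount (shift b j) p x → -(M : ℤ) + 2 ≤ classExp (shift b j) p x)
    (hN2' : ∀ y < p, classPoleCount (shift b j) p y = 1 → -(M : ℤ) + 2 ≤ classNu (shift b j) p y)
    (hcas : casoratian b j ≠ 0) : (9 : ℤ) - 2 * M ≤ padicValRat p (casoratian b j) := by
  obtain ⟨hj1, hj7⟩ := hj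
  obtain ⟨hM, hMe⟩ := hM
  have hprime : p.Prime := hp.out
  have hp0 : (p : ℚ) ≠ 0 := Nat.cast_ne_zero.2 hprime.ne_zero
  have hpneg : (-(p : ℚ)) ≠ 0 := neg_ne_zero.2 hp0
  have hp2 : p ≠ 2 := by omega
  have hpb' : (p : ℤ) ≤ shift b j 0 := by rw [shift_zero b hj1]; exact hpb
  have hwin' : (shift b j 0 + 2 : ℤ) < (p : ℤ) ^ 2 := by rw [shift_zero b hj1]; exact hwin
  have h2n : padicNorm p (2 : ℚ) = 1 := padicNorm_two hp2
  -- `w, v, w', v'` are `O(p²)`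
  obtain ⟨hWb, hVb⟩ := coeff_norm_of_layer b hb hp5 hwin (k := 2) (by omega) hE2 hN2
  obtain ⟨hWb', hVb'⟩ := coeff_norm_of_layer (shift b j) hb' hp5 hwin' (k := 2) (by omega) hE2' hN2'
  have hw2 : padicNorm p (coeffW b / (-(p : ℚ)) ^ (-(M : ℤ) + 3)) ≤ (p : ℚ) ^ (-(2 : ℤ)) :=
    norm_div_neg_p_zpow (by rw [show -(-(M : ℤ) + 3 + 2) = -((-(M : ℤ) + 2) + 3) by ring]; exact hWb)
  have hv2 : padicNorm p (coeffV b / (-(p : ℚ)) ^ (-(M : ℤ))) ≤ (p : ℚ) ^ (-(2 : ℤ)) :=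
    norm_div_neg_p_zpow (by rw [show -(-(M : ℤ) + 2) = -(-(M : ℤ) + 2) by ring]; exact hVb)
  have hw2' : padicNorm p (coeffW (shift b j) / (-(p : ℚ)) ^ (-(M : ℤ) + 3)) ≤ (p : ℚ) ^ (-(2 : ℤ)) :=
    norm_div_neg_p_zpow (by rw [show -(-(M : ℤ) + 3 + 2) = -((-(M : ℤ) + 2) + 3) by ring]; exact hWb')
  have hv2' : padicNorm p (coeffV (shift b j) / (-(p : ℚ)) ^ (-(M : ℤ))) ≤ (p : ℚ) ^ (-(2 : ℤ)) :=
    norm_div_neg_p_zpow (by rw [show -(-(M : ℤ) + 2) = -(-(M : ℤ) + 2) by ring]; exact hVb')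
  -- the minor `w'v − wv'` is `O(p⁶)`
  have hdet : padicNorm p (coeffW (shift b j) / (-(p : ℚ)) ^ (-(M : ℤ) + 3) * (coeffV b / (-(p : ℚ)) ^ (-(M : ℤ)))
      - coeffW b / (-(p : ℚ)) ^ (-(M : ℤ) + 3) * (coeffV (shift b j) / (-(p : ℚ)) ^ (-(M : ℤ)))) ≤ (p : ℚ) ^ (-(6 : ℤ)) := by
    by_cases hA : ∃ x < p, (2 ≤ classPoleCount b p x ∧ classExp b p x ≤ -(M : ℤ) + 2) ∨
        (2 ≤ classPoleCount (shift b j) p x ∧ classExp (shift b j) p x ≤ -(M : ℤ) + 2)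
    · -- (A) a live class below the top layer: `E(T) = −M`, `L(T) < p`, collinearity mod `p⁴` with `O(p²)` directions
      obtain ⟨x, hx, hx'⟩ := hA
      have hTL : typeExp (tTop T) (tList T) = -(M : ℤ) ∧ tTop T < p := by
        rcases hx' with ⟨h2, hE⟩ | ⟨h2, hE⟩
        · refine ⟨(typeExp_frame_or_top b hb hp5 hpb hMe hT hC hx h2 (by omega)).resolve_right (by omega), ?_⟩
          obtain ⟨a, hdom⟩ := live_dominates b hpb hC hS hx h2 (by omega)
          have := hdom.le; have := topLevel_lt b hb hwin x; omega
        · refine ⟨(typeExp_frame_or_top (shift b j) hb' hp5 hpb' hMe hT hC' hx h2 (by omega)).resolve_right (by omega), ?_⟩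
          obtain ⟨a, hdom⟩ := live_dominates (shift b j) hpb' hC' hS' hx h2 (by omega)
          have := hdom.le; have := topLevel_lt (shift b j) hb' hwin' x; omega
      obtain ⟨hTM, hLp⟩ := hTL
      have hres := liveKappaSum_small b hb hp5 hpb hwin hM hMe hC.1 (by omega)
      have hres' := liveKappaSum_small (shift b j) hb' hp5 hpb' hwin' hM hMe hC'.1 (by rw [dOf_shift b hj1 hj7]; omega)
      obtain ⟨A, -, hW, hV⟩ :=
        aggregate₅ b hb hp5 hpb hwin hM hMe hT hC hS fourthDigitW_holds fourthDigitV_holds hTM hres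
      obtain ⟨A', -, hW', hV'⟩ :=
        aggregate₅ (shift b j) hb' hp5 hpb' hwin' hM hMe hT hC' hS' fourthDigitW_holds fourthDigitV_holds hTM hres'
      -- `A t = 2w − (2w − A t)` is `O(p²)`
      have hAt : ∀ {c At : ℚ}, padicNorm p c ≤ (p : ℚ) ^ (-(2 : ℤ)) → padicNorm p (2 * c - At) ≤ (p : ℚ) ^ (-(4 : ℤ)) →
          padicNorm p At ≤ (p : ℚ) ^ (-(2 : ℤ)) := by
        intro c At hc hr
        have e : At = 2 * c - (2 * c - At) := by ring
        rw [e]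
        refine fo_sub ?_ (fo_weak hr (by norm_num))
        rw [padicNorm.mul, h2n, one_mul]; exact hc
      exact det₆ hp2 hW hV hW' hV' (hAt hw2 hW) (hAt hv2 hV) (hAt hw2' hW') (hAt hv2' hV')
    · -- (B) every multipole class of both vectors has `E ≥ −M + 3`: crude bounds
      have hall : ∀ x < p, 2 ≤ classPoleCount b p x → -(M : ℤ) + 3 ≤ classExp b p x := fun x hx h2 => by
        by_contra h; exact hA ⟨x, hx, Or.inl ⟨h2, by omega⟩⟩
      have hall' : ∀ x < p, 2 ≤ classPoleCount (shift b j) p x → -(M : ℤ) + 3 ≤ classExp (shift b j) p x :=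
        fun x hx h2 => by
          by_contra h; exact hA ⟨x, hx, Or.inr ⟨h2, by omega⟩⟩
      obtain ⟨hWt, hVt⟩ := coeff_norm_of_top b hb hp5 hwin hM hall
      obtain ⟨hWt', hVt'⟩ := coeff_norm_of_top (shift b j) hb' hp5 hwin' hM hall'
      have hw := norm_div_neg_p_zpow hWt
      have hv := norm_div_neg_p_zpow hVt
      have hw' := norm_div_neg_p_zpow hWt'
      have hv' := norm_div_neg_p_zpow hVt'
      exact fo_sub (fo_weak (fo_mul hw' hv) (by norm_num)) (fo_weak (fo_mul hw hv') (by norm_num))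
  -- the Casoratian
  set w := coeffW b / (-(p : ℚ)) ^ (-(M : ℤ) + 3)
  set v := coeffV b / (-(p : ℚ)) ^ (-(M : ℤ))
  set w' := coeffW (shift b j) / (-(p : ℚ)) ^ (-(M : ℤ) + 3)
  set v' := coeffV (shift b j) / (-(p : ℚ)) ^ (-(M : ℤ))
  have hcasE : casoratian b j = (-(p : ℚ)) ^ (-(M : ℤ) + 3) * (-(p : ℚ)) ^ (-(M : ℤ)) * (w' * v - w * v') := by
    have e1 : coeffW b = w * (-(p : ℚ)) ^ (-(M : ℤ) + 3) := by
      simp only [w]; rw [div_mul_cancel₀ _ (zpow_ne_zero _ hpneg)]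
    have e2 : coeffV b = v * (-(p : ℚ)) ^ (-(M : ℤ)) := by
      simp only [v]; rw [div_mul_cancel₀ _ (zpow_ne_zero _ hpneg)]
    have e3 : coeffW (shift b j) = w' * (-(p : ℚ)) ^ (-(M : ℤ) + 3) := by
      simp only [w']; rw [div_mul_cancel₀ _ (zpow_ne_zero _ hpneg)]
    have e4 : coeffV (shift b j) = v' * (-(p : ℚ)) ^ (-(M : ℤ)) := by
      simp only [v']; rw [div_mul_cancel₀ _ (zpow_ne_zero _ hpneg)]
    unfold casoratian
    rw [e1, e2, e3, e4]; ring
  apply val_ge_of_padicNorm_le hcas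
  rw [hcasE, padicNorm.mul, padicNorm.mul, LevelClass.padicNorm_neg_p_zpow, LevelClass.padicNorm_neg_p_zpow]
  calc (p : ℚ) ^ (-(-(M : ℤ) + 3)) * (p : ℚ) ^ (-(-(M : ℤ))) * padicNorm p (w' * v - w * v')
      ≤ (p : ℚ) ^ (-(-(M : ℤ) + 3)) * (p : ℚ) ^ (-(-(M : ℤ))) * (p : ℚ) ^ (-(6 : ℤ)) :=
        mul_le_mul_of_nonneg_left hdet (mul_nonneg (zpow_p_nonneg _) (zpow_p_nonneg _))
    _ = (p : ℚ) ^ (-((9 : ℤ) - 2 * M)) := by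
        rw [← zpow_add₀ hp0, ← zpow_add₀ hp0]; congr 1; ring

end Summit.KontsevichZagierPeriods.Zeta5Search.SecondOrder

end
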